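import Summits.ResolutionOfSingularities.ResolutionOfSingularities.Theorems.WeightedInvariantIota3FibreRadical
import Summits.ResolutionOfSingularities.ResolutionOfSingularities.Theorems.WeightedInvariantKeyRungThreeOfResidue
import Summits.ResolutionOfSingularities.ResolutionOfSingularities.Theorems.WeightedInvariantIota3JSigmaDominanceSecondMember
import Summits.ResolutionOfSingularities.ResolutionOfSingularities.Theorems.WeightedInvariantIota3TwoFlagCompletion
import HarnessLib

/-!
# (INV)₃ IS THE RESIDUE OF THE DOMINANCE WORD: the gap list of `stub_keyRungGrHomLE_three` with hINV and hres MERGED into one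
# second-member residue over all regular local rings of dimension three (door `HypersurfaceCentreConstruction`,
# stmt-ResolutionOfSingularities-19897)

Helper for `stub_keyRungGrHomLE_three` (def-free, `--supports 19897`).  Sequel of …Iota3FibreRadical, whose gap list of record
`keyRungGrHomLE_three_of_invariance4` carries FOUR hypotheses hD, **(INV)₃**, hgame, **hres**.  Here (INV)₃ — «two two-flags carrying
`0 ≠ g ∈ 𝔪` to level `r₁ν` of the same exactly ratio-maximal admissible `(q; r₁, r₂)`, `q < r₂`, have comparable levels `r₁`, `r₂`» — is
ASSEMBLED from the tree: the ratio-one regime (`Iota3.dominanceAtLevel_of_r₁_eq_r₂`), the word outright off the power positions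
(`Iota3.twoFlagDominanceAtLevelAt_of_not_power`), (E1) «the second membership gives the first» (`Iota3.mem_weight₁_of_mem_weight₂`, with the
r.s.p. completion `Iota3.exists_span_triple_of_isTwoFlag`) and the multiplicativity upgrade (`Iota3.flagContactFiltration_le_of_mem`), MODULO the
single membership `g₂' ∈ F_{(g₁,g₂)}(r₂)` at the power positions `in(g) = c·ℓ^ν` with `q < r₂ < r₁` — the SAME residue hres asks for, but over
every regular local ring of dimension three and with no position prefix (`SecondMemberResidue3`, spelled inline as a binder).  Since hres is a
literal specialisation of that binder, the GAP LIST OF RECORD becomes **`keyRungGrHomLE_three_of_residue3`**: THREE hypotheses hD (desc-τ as typed;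
door-proved), hgame, hres₃ (second-member dominance at the power positions, `q < r₂ < r₁`, all regular local rings of dimension three).
[OURS · L1 W4.3 · audit glue; AI work, weaker than expert review; nothing here is a statement of the manuscript under review.]
-/

noncomputable section

open IsLocalRing Literature.AlgebraicGeometry.Resolution
open Summit.ResolutionOfSingularities.ResolutionOfSingularities.Theorems

set_option linter.dupNamespace false -- mandated namespace of this single-conjunct summit

namespace Summit.ResolutionOfSingularities.ResolutionOfSingularities.Cruxes.HypersurfaceCentreConstruction.LocalEngine

namespace Iota3

/-- **(INV)₃ at one ring from the second-member residue at that ring.**  `A` regular local of dimension three, `0 ≠ g ∈ 𝔪`; if at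
`(A, g)` the second member of every two-flag reaching an exactly ratio-maximal `(q; r₁, r₂)` with `q < r₂ < r₁` lies in level `r₂` of any
other such flag whenever `in(g)` is a `ν`-th power of a linear form, then the two filtrations of two such flags at any exactly
ratio-maximal `(q; r₁, r₂)` with `q < r₂` are comparable at the levels `r₁` and `r₂`. [OURS · L1 W4.3 · (o70-b)/(Δ12) assembly] -/
theorem levels_le_of_secondMemberResidue {A : Type} [CommRing A] [IsRegularLocalRing A] (hdim : ringKrullDim A = (3 : ℕ))
    {g : A} (hg0 : g ≠ 0) (hgm : g ∈ maximalIdeal A)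
    (hres : (∃ ℓ ∈ maximalIdeal A, g ∈ Ideal.span {ℓ ^ (adicOrder g).toNat} ⊔ maximalIdeal A ^ ((adicOrder g).toNat + 1)) →
      ∀ (a b : ℕ), 0 < b →
      (∀ q' r₁' r₂' : ℕ, AdmissibleTriple q' r₁' r₂' → FlagReaches g (adicOrder g).toNat q' r₁' r₂' → r₁' * b ≤ a * r₂') →
      ∀ (g₁ g₂ g₁' g₂' : A) (q r₁ r₂ : ℕ), AdmissibleTriple q r₁ r₂ → r₁ * b = a * r₂ → q < r₂ → r₂ < r₁ →
        IsTwoFlag g₁ g₂ → IsTwoFlag g₁' g₂' →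
        g ∈ flagContactFiltration g₁ g₂ q r₁ r₂ (r₁ * (adicOrder g).toNat) →
        g ∈ flagContactFiltration g₁' g₂' q r₁ r₂ (r₁ * (adicOrder g).toNat) →
        g₂' ∈ flagContactFiltration g₁ g₂ q r₁ r₂ r₂)
    {g₁ g₂ g₁' g₂' : A} {q r₁ r₂ : ℕ} (hΦ : IsTwoFlag g₁ g₂) (hΦ' : IsTwoFlag g₁' g₂') (hadm : AdmissibleTriple q r₁ r₂)
    (hq₂ : q < r₂) (hF : g ∈ flagContactFiltration g₁ g₂ q r₁ r₂ (r₁ * (adicOrder g).toNat))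
    (hF' : g ∈ flagContactFiltration g₁' g₂' q r₁ r₂ (r₁ * (adicOrder g).toNat))
    (hmax : ∀ q' r₁' r₂' : ℕ, AdmissibleTriple q' r₁' r₂' → FlagReaches g (adicOrder g).toNat q' r₁' r₂' → r₁' * r₂ ≤ r₁ * r₂') :
    flagContactFiltration g₁' g₂' q r₁ r₂ r₁ ≤ flagContactFiltration g₁ g₂ q r₁ r₂ r₁ ∧
      flagContactFiltration g₁' g₂' q r₁ r₂ r₂ ≤ flagContactFiltration g₁ g₂ q r₁ r₂ r₂ := by
  have hq : 0 < q := hadm.1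
  have hb : 0 < r₂ := lt_of_lt_of_le hq hadm.2.1
  -- both memberships, then the multiplicativity upgrade
  suffices hmem : g₁' ∈ flagContactFiltration g₁ g₂ q r₁ r₂ r₁ ∧ g₂' ∈ flagContactFiltration g₁ g₂ q r₁ r₂ r₂ by
    exact ⟨flagContactFiltration_le_of_mem hq hmem.1 hmem.2 r₁, flagContactFiltration_le_of_mem hq hmem.1 hmem.2 r₂⟩
  rcases (hadm.2.2 : r₂ ≤ r₁).eq_or_lt with hrr | hlt
  · -- ratio one
    exact dominanceAtLevel_of_r₁_eq_r₂ hdim hg0 hgm hb hmax hadm rfl hrr.symm hΦ hΦ' hF hF'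
  · by_cases hP : ∃ ℓ ∈ maximalIdeal A, g ∈ Ideal.span {ℓ ^ (adicOrder g).toNat} ⊔ maximalIdeal A ^ ((adicOrder g).toNat + 1)
    · -- power position: the residue gives the second membership, (E1) the first
      have h₂ : g₂' ∈ flagContactFiltration g₁ g₂ q r₁ r₂ r₂ :=
        hres hP r₁ r₂ hb hmax g₁ g₂ g₁' g₂' q r₁ r₂ hadm rfl hq₂ hlt hΦ hΦ' hF hF'
      obtain ⟨x, hx, -⟩ := exists_span_triple_of_isTwoFlag A hdim g₁ g₂ hΦ
      obtain ⟨hν, -, hford⟩ := EssSmoothLevels.adicOrder_toNat_spec hg0 hgm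
      exact ⟨mem_weight₁_of_mem_weight₂ (by rw [hdim]; rfl) hx hq hadm.2.1 hlt hν hford hF hΦ'.1 hΦ'.2.1 hF' h₂, h₂⟩
    · -- off the power positions the word holds outright
      push Not at hP
      exact twoFlagDominanceAtLevelAt_of_not_power hdim hg0 hgm hP r₁ r₂ hb hmax g₁ g₂ g₁' g₂' q r₁ r₂ hadm rfl hΦ hΦ' hF hF'

end Iota3

open Iota3 in
/-- **GAP LIST OF RECORD for `stub_keyRungGrHomLE_three` — hINV and hres MERGED**: `KeyRungGrHomLE 3 p` from hD (desc-τ as typed;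
door-proved `Iota3.isTiePosition_descent_door`), hgame, and **hres₃** «in every regular local ring of dimension three, at `0 ≠ f ∈ 𝔪`
whose tangent form is `c·ℓ^ν`, under the ratio bound `a/b`, for two two-flags carrying `f` to level `r₁ν` of a common admissible
`(q; r₁, r₂)` of ratio `a/b` with `q < r₂ < r₁`: `g₂' ∈ F_{(g₁,g₂)}(r₂)`» (= the hypothesis hres of `keyRungGrHomLE_three_of_invariance4`
without its position prefix, over all regular local rings).  (`keyRungGrHomLE_three_of_invariance4` ∘ `Iota3.levels_le_of_secondMemberResidue`.)
[OURS · L1 W4.3 · audit glue] -/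
theorem keyRungGrHomLE_three_of_residue3 (p : ℕ)
    (hD : ∀ (T T' : Type) [CommRing T] [IsRegularLocalRing T] [CommRing T'] [IsRegularLocalRing T'] [Algebra T T']
      [IsLocalHom (algebraMap T T')] [Algebra.FormallySmooth T T'] [Algebra.EssFiniteType T T'] (g : T),
      ringKrullDim T' ≤ 3 → IsTiePosition T' (algebraMap T T' g) → IsTiePosition T g)
    (hgame : CanonicalGameClauseHomLE 3 p iotaFlatT jFlatT)
    (hres₃ : ∀ (A : Type) [CommRing A] [IsRegularLocalRing A] (f : A),
      ringKrullDim A = (3 : ℕ) → f ≠ 0 → f ∈ maximalIdeal A →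
      (∃ ℓ ∈ maximalIdeal A, f ∈ Ideal.span {ℓ ^ (adicOrder f).toNat} ⊔ maximalIdeal A ^ ((adicOrder f).toNat + 1)) →
      ∀ (a b : ℕ), 0 < b →
      (∀ q' r₁' r₂' : ℕ, AdmissibleTriple q' r₁' r₂' → FlagReaches f (adicOrder f).toNat q' r₁' r₂' → r₁' * b ≤ a * r₂') →
      ∀ (g₁ g₂ g₁' g₂' : A) (q r₁ r₂ : ℕ), AdmissibleTriple q r₁ r₂ → r₁ * b = a * r₂ → q < r₂ → r₂ < r₁ →
        IsTwoFlag g₁ g₂ → IsTwoFlag g₁' g₂' →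
        f ∈ flagContactFiltration g₁ g₂ q r₁ r₂ (r₁ * (adicOrder f).toNat) →
        f ∈ flagContactFiltration g₁' g₂' q r₁ r₂ (r₁ * (adicOrder f).toNat) →
        g₂' ∈ flagContactFiltration g₁ g₂ q r₁ r₂ r₂) :
    KeyRungGrHomLE 3 p :=
  keyRungGrHomLE_three_of_invariance4 p hD
    (fun A _ _ g hdim hg0 hgm _ _ _ _ _ _ _ hΦ hΦ' hadm hq₂ hF hF' hmax =>
      levels_le_of_secondMemberResidue hdim hg0 hgm (hres₃ A g hdim hg0 hgm) hΦ hΦ' hadm hq₂ hF hF' hmax)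
    hgame
    (fun _ _ _ _ S _ _ _ _ f hdim hf0 hf2 _ _ hpow a b hb hbound g₁ g₂ g₁' g₂' q r₁ r₂ hadm hab hq₂ hlt hΦ hΦ' hF hF' =>
      hres₃ S f hdim hf0 (Ideal.pow_le_self two_ne_zero hf2) hpow a b hb hbound g₁ g₂ g₁' g₂' q r₁ r₂ hadm hab hq₂ hlt hΦ hΦ'
        hF hF')

end Summit.ResolutionOfSingularities.ResolutionOfSingularities.Cruxes.HypersurfaceCentreConstruction.LocalEngine

end
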